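import Literature.AlgebraicGeometry.Resolution.StalkBaseChangeChart
import Literature.AlgebraicGeometry.Resolution.AlterationsSemiStableCodimTwoBlowupFibreModels
import Literature.AlgebraicGeometry.Resolution.CompletionBaseChange
import HarnessLib

/-!
# Completed local rings of `Y ×_{Spec D} Spec E` at the points over `y₀`, for `D → E` bijective on levels

Topic: `Literature/AlgebraicGeometry/Resolution`. Continues `StalkBaseChangeChart.lean` (the flat
pre-immersion `Spec (𝒪_{Y,y₀} ⊗_D E) → Y ×_{Spec D} Spec E`, `stalkTensorChart`) with the
completion statement used in de Jong 1996, 3.4, Claim (ii) ("completion and blowing up commute in a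
suitable manner"): if `q : Y → Spec D`, `y₀ ∈ Y`, and `D → E` is bijective on all levels
`D/𝔭ⁿ → E/𝔭ⁿE` for an ideal `𝔭` mapping into `𝔪_{y₀}` (e.g. `E = D̂` for `D` local, or a formal
model `𝒪_{X,x} → 𝒪̂_{X,x} ≅ Λ⟦u, v⟧/(uv - c t²)`), then

* `asIdeal_eq_of_fst_eq`, `eq_of_fst_eq_of_fst_eq`, `isClosed_singleton_of_fst_eq` — there is
  exactly ONE point of `Y ×_D Spec E` over `y₀` (its prime in the chart ring `𝒪_{Y,y₀} ⊗_D E` is the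
  maximal ideal `𝔪_{y₀} ⊗ E`, `isMaximal_map_tensorInr` of `CompletionBaseChange.lean`), closed if
  `y₀` is;
* `nonempty_localCpl_stalkOver_ringEquiv_localCpl_stalk_pullback` — **its completed local ring is
  `𝒪̂_{Y,y₀}`**: `𝒪̂_{Y,y₀} ≅ (E ⊗_D 𝒪_{Y,y₀})^_{𝔪_{y₀}}` (`completionTensorBaseEquiv`) and the local
  ring of the fibre product at the point is the localisation of `E ⊗_D 𝒪_{Y,y₀}` at that maximal
  ideal, whose completion is the same (`adicCompletionEquivOfIsLocalizationAtMaximal`);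
* `algebraMap_stalkOver_eq`, `map_le_localMaxIdeal_of_le_asIdeal` — bookkeeping: the `D`-algebra
  structure of `𝒪_{Y,y₀}` is `D → 𝒪_{Spec D, q y₀} → 𝒪_{Y,y₀}`, so an ideal contained in the prime
  of `q y₀` extends into `𝔪_{y₀}`.

## Sources

* A. J. de Jong, *Smoothness, semi-stability and alterations*, Publ. Math. IHÉS 83 (1996), 3.4,
  p. 64 ("completion and blowing up commute"). [DeJong1996]
* The Stacks Project, Tag 05GG; H. Matsumura, *Commutative Ring Theory* (1986), Thm. 8.11.
-/

noncomputable section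

open CategoryTheory CategoryTheory.Limits AlgebraicGeometry TopologicalSpace TensorProduct

namespace Literature.AlgebraicGeometry.Resolution

universe u

section Bookkeeping

variable {D : Type u} [CommRing D] (E : Type u) [CommRing E] [Algebra D E] {Y : Scheme.{u}}
  (q : Y ⟶ Spec (.of D)) (y₀ : Y)

/-- **The algebra structure map of `StalkOver q y₀` is the stalk map**: `D → 𝒪_{Spec D, q y₀} → 𝒪_{Y,y₀}`
(both have `Spec` equal to `Spec 𝒪_{Y,y₀} → Y → Spec D`, and `Spec` is faithful). [folklore] -/
theorem algebraMap_stalkOver_eq :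
    (algebraMap D (StalkOver q y₀) : D →+* StalkOver q y₀) =
      ((StalkOver.iso q y₀).hom.hom.comp (q.stalkMap y₀).hom).comp
        (StructureSheaf.toStalk D (q y₀)).hom := by
  have h : Spec.map (CommRingCat.ofHom (algebraMap D (StalkOver q y₀))) =
      Spec.map (StructureSheaf.toStalk D (q y₀) ≫ q.stalkMap y₀ ≫ (StalkOver.iso q y₀).hom) := by
    rw [← fromSpecStalk_comp_eq, StalkOver.fromSpec, Category.assoc, ← Scheme.SpecMap_stalkMap_fromSpecStalk,
      Spec.fromSpecStalk_eq', Spec.map_comp, Spec.map_comp, Category.assoc]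
    rfl
  have h2 := Spec.map_injective h
  have h3 := congrArg CommRingCat.Hom.hom h2
  rw [CommRingCat.hom_ofHom] at h3
  rw [h3]
  rfl


/-- An ideal of `D` contained in the prime of `q y₀` extends into the maximal ideal of `𝒪_{Y,y₀}`
(`D → 𝒪_{Spec D, q y₀}` sends that prime into the maximal ideal, and the stalk map is local).
[folklore] -/
theorem map_le_localMaxIdeal_of_le_asIdeal {𝔭 : Ideal D} (h : 𝔭 ≤ (q y₀).asIdeal) :
    𝔭.map (algebraMap D (StalkOver q y₀)) ≤ localMaxIdeal (StalkOver q y₀) := by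
  rw [Ideal.map_le_iff_le_comap]
  intro x hx
  rw [Ideal.mem_comap, algebraMap_stalkOver_eq, RingHom.comp_apply, RingHom.comp_apply]
  let St : Type u := ↥((Spec (.of D)).presheaf.stalk (q y₀))
  letI : Algebra D St := (StructureSheaf.toStalk D (q y₀)).hom.toAlgebra
  haveI : IsLocalization.AtPrime St (q y₀).asIdeal := StructureSheaf.IsLocalization.to_stalk D (q y₀)
  have h1 : algebraMap D St x ∈ IsLocalRing.maximalIdeal St := by
    rw [IsLocalRing.mem_maximalIdeal, mem_nonunits_iff,
      IsLocalization.AtPrime.isUnit_to_map_iff St (q y₀).asIdeal x]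
    exact fun hn => hn (h hx)
  have hloc : IsLocalHom (q.stalkMap y₀).hom := inferInstance
  have h2 : (IsLocalRing.maximalIdeal St).map (q.stalkMap y₀).hom ≤
      IsLocalRing.maximalIdeal (Y.presheaf.stalk y₀) :=
    ((IsLocalRing.local_hom_TFAE (q.stalkMap y₀).hom).out 0 2).mp hloc
  exact h2 (Ideal.mem_map_of_mem _ h1)

end Bookkeeping

/-! ## The unique point over `y₀` -/

section UniquePoint

open IsLocalRing

variable {D : Type u} [CommRing D] (E : Type u) [CommRing E] [Algebra D E] {Y : Scheme.{u}}
  (q : Y ⟶ Spec (.of D)) (y₀ : Y) (𝔭 : Ideal D)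
  (hR' : ∀ n, Function.Bijective
    (Ideal.quotientMap ((𝔭 ^ n).map (algebraMap D E)) (algebraMap D E) Ideal.le_comap_map))
  (h𝔫 : 𝔭.map (algebraMap D (StalkOver q y₀)) ≤ localMaxIdeal (StalkOver q y₀))

include hR' h𝔫 in
/-- `𝔪_{y₀} ⊗ E ⊆ 𝒪_{Y,y₀} ⊗_D E` is a maximal ideal. [folklore] -/
theorem isMaximal_map_includeLeft :
    ((localMaxIdeal (StalkOver q y₀)).map (Algebra.TensorProduct.includeLeftRingHom (R := D)
      (A := StalkOver q y₀) (B := E))).IsMaximal := by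
  set C := StalkOver q y₀
  haveI : (localMaxIdeal C).IsMaximal := IsLocalRing.maximalIdeal.isMaximal C
  haveI hmax := isMaximal_map_tensorInr 𝔭 hR' (localMaxIdeal C) h𝔫
  let κ : (C ⊗[D] E) ≃+* (E ⊗[D] C) := (Algebra.TensorProduct.comm D C E).toRingEquiv
  have hcomp : (κ.symm : E ⊗[D] C →+* C ⊗[D] E).comp (tensorInr D E C) =
      Algebra.TensorProduct.includeLeftRingHom (R := D) (A := C) (B := E) := by
    ext c
    rfl
  have h : (localMaxIdeal C).map (Algebra.TensorProduct.includeLeftRingHom (R := D) (A := C) (B := E)) =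
      ((localMaxIdeal C).map (tensorInr D E C)).map (κ.symm : E ⊗[D] C →+* C ⊗[D] E) := by
    rw [Ideal.map_map, hcomp]
  rw [h]
  exact hmax.map_bijective _ κ.symm.bijective

include hR' h𝔫 in
/-- **The prime of a point over `y₀` in the chart ring is `𝔪_{y₀} ⊗ E`.** [folklore] -/
theorem asIdeal_eq_of_fst_eq {t : Spec (.of (StalkOver q y₀ ⊗[D] E))}
    (ht : pullback.fst q (specOfAlgebra D E) (stalkTensorChart E q y₀ t) = y₀) :
    t.asIdeal = (localMaxIdeal (StalkOver q y₀)).map (Algebra.TensorProduct.includeLeftRingHom (R := D)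
      (A := StalkOver q y₀) (B := E)) :=
  ((isMaximal_map_includeLeft E q y₀ 𝔭 hR' h𝔫).eq_of_le t.isPrime.ne_top
    (map_maximalIdeal_le_asIdeal E q y₀ ht)).symm

include hR' h𝔫 in
/-- **There is only one point of `Y ×_{Spec D} Spec E` over `y₀`.** [folklore] -/
theorem eq_of_fst_eq_of_fst_eq {y₁ y₂ : ↑(pullback q (specOfAlgebra D E))}
    (h₁ : pullback.fst q (specOfAlgebra D E) y₁ = y₀) (h₂ : pullback.fst q (specOfAlgebra D E) y₂ = y₀) :
    y₁ = y₂ := by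
  obtain ⟨t₁, rfl⟩ := exists_stalkTensorChart_eq E q y₀ y₁ (by rw [h₁])
  obtain ⟨t₂, rfl⟩ := exists_stalkTensorChart_eq E q y₀ y₂ (by rw [h₂])
  have h : t₁ = t₂ := PrimeSpectrum.ext
    ((asIdeal_eq_of_fst_eq E q y₀ 𝔭 hR' h𝔫 h₁).trans (asIdeal_eq_of_fst_eq E q y₀ 𝔭 hR' h𝔫 h₂).symm)
  rw [h]

include hR' h𝔫 in
/-- **The point of `Y ×_{Spec D} Spec E` over a closed point `y₀` is closed** (it is the whole
fibre over `y₀`). [folklore] -/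
theorem isClosed_singleton_of_fst_eq {y : ↑(pullback q (specOfAlgebra D E))}
    (hy : pullback.fst q (specOfAlgebra D E) y = y₀) (h : IsClosed ({y₀} : Set Y)) :
    IsClosed ({y} : Set ↑(pullback q (specOfAlgebra D E))) := by
  have he : ({y} : Set ↑(pullback q (specOfAlgebra D E))) = pullback.fst q (specOfAlgebra D E) ⁻¹' {y₀} := by
    ext z
    simp only [Set.mem_singleton_iff, Set.mem_preimage]
    exact ⟨fun hz => hz ▸ hy, fun hz => eq_of_fst_eq_of_fst_eq E q y₀ 𝔭 hR' h𝔫 hz hy⟩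
  rw [he]
  exact h.preimage (pullback.fst q (specOfAlgebra D E)).continuous

end UniquePoint

/-! ## The completed local ring at the point over `y₀` -/

section CompletionBaseChangeStalk

open IsLocalRing

variable {D : Type u} [CommRing D] (E : Type u) [CommRing E] [Algebra D E] {Y : Scheme.{u}}
  (q : Y ⟶ Spec (.of D)) (y₀ : Y) (𝔭 : Ideal D)
  (hR' : ∀ n, Function.Bijective
    (Ideal.quotientMap ((𝔭 ^ n).map (algebraMap D E)) (algebraMap D E) Ideal.le_comap_map))
  (h𝔫 : 𝔭.map (algebraMap D (StalkOver q y₀)) ≤ localMaxIdeal (StalkOver q y₀))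

include hR' h𝔫 in
/-- **The completed local rings of `Y ×_{Spec D} Spec E` at the points over `y₀` are the completed
local ring `𝒪̂_{Y,y₀}`**, when `D → E` is bijective on all levels `D/𝔭ⁿ → E/𝔭ⁿE` and `𝔭` maps
into `𝔪_{y₀}` (e.g. `E = D^_𝔭` for a maximal `𝔭`, or `E` the completion of a local `D`): the
completion commutes with this base change (`completionTensorBaseEquiv`), and the local ring of
the base change at such a point is the localization of `E ⊗_D 𝒪_{Y,y₀}` at the maximal ideal
`𝔪_{y₀}(E ⊗_D 𝒪_{Y,y₀})` (`stalkTensorChart` and its stalk isomorphisms), whose completion at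
that maximal ideal is unchanged by localizing (`adicCompletionEquivOfIsLocalizationAtMaximal`).
[folklore] -/
theorem nonempty_localCpl_stalkOver_ringEquiv_localCpl_stalk_pullback
    (y : ↑(pullback q (specOfAlgebra D E))) (hy : pullback.fst q (specOfAlgebra D E) y = y₀) :
    Nonempty (LocalCpl (StalkOver q y₀) ≃+* LocalCpl ((pullback q (specOfAlgebra D E)).presheaf.stalk y)) := by
  classical
  set C := StalkOver q y₀ with hC
  set 𝔫 : Ideal C := localMaxIdeal C with h𝔫def
  -- the point of the chart over `y`
  obtain ⟨t, rfl⟩ := exists_stalkTensorChart_eq E q y₀ y (by rw [hy])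
  set P := pullback q (specOfAlgebra D E)
  set L : Type u := ↥(P.presheaf.stalk (stalkTensorChart E q y₀ t)) with hL
  set St : Type u := ↥((Spec (.of (C ⊗[D] E))).presheaf.stalk t) with hSt
  -- `L ≅ (C ⊗ E)_t`, so `L` is a localization of `C ⊗ E` at `t`
  let φ : P.presheaf.stalk (stalkTensorChart E q y₀ t) ≅ (Spec (.of (C ⊗[D] E))).presheaf.stalk t :=
    asIso ((stalkTensorChart E q y₀).stalkMap t)
  letI algSt : Algebra (C ⊗[D] E) St := (StructureSheaf.toStalk (C ⊗[D] E) t).hom.toAlgebra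
  haveI hlocSt : IsLocalization.AtPrime St t.asIdeal := StructureSheaf.IsLocalization.to_stalk (C ⊗[D] E) t
  letI algL : Algebra (C ⊗[D] E) L := (φ.inv.hom.comp (algebraMap (C ⊗[D] E) St)).toAlgebra
  haveI hlocL : IsLocalization.AtPrime L t.asIdeal := by
    let ε : St ≃ₐ[C ⊗[D] E] L :=
      AlgEquiv.ofRingEquiv (f := φ.symm.commRingCatIsoToRingEquiv) (fun x => rfl)
    exact IsLocalization.isLocalization_of_algEquiv t.asIdeal.primeCompl ε
  -- switch the factors: `E ⊗ C`
  let κ : (C ⊗[D] E) ≃+* (E ⊗[D] C) := (Algebra.TensorProduct.comm D C E).toRingEquiv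
  letI algL' : Algebra (E ⊗[D] C) L := ((algebraMap (C ⊗[D] E) L).comp κ.symm.toRingHom).toAlgebra
  haveI hloc' : IsLocalization (t.asIdeal.primeCompl.map κ) L :=
    IsLocalization.isLocalization_of_base_ringEquiv t.asIdeal.primeCompl L κ
  -- the prime of `E ⊗ C` below the point is `𝔫' = 𝔪_{y₀}(E ⊗ C)`
  set 𝔫' : Ideal (E ⊗[D] C) := 𝔫.map (tensorInr D E C) with h𝔫'
  haveI : 𝔫.IsMaximal := IsLocalRing.maximalIdeal.isMaximal C
  haveI h𝔫'max : 𝔫'.IsMaximal := isMaximal_map_tensorInr 𝔭 hR' 𝔫 h𝔫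
  set Q : Ideal (E ⊗[D] C) := t.asIdeal.comap κ.symm.toRingHom with hQ
  haveI hQp : Q.IsPrime := Ideal.comap_isPrime _ _
  have hle : 𝔫' ≤ Q := by
    rw [h𝔫', Ideal.map_le_iff_le_comap]
    intro c hc
    rw [Ideal.mem_comap, hQ, Ideal.mem_comap]
    have h1 : κ.symm.toRingHom (tensorInr D E C c) =
        Algebra.TensorProduct.includeLeftRingHom (R := D) (A := C) (B := E) c := by
      change (Algebra.TensorProduct.comm D C E).symm ((1 : E) ⊗ₜ[D] c) = c ⊗ₜ[D] (1 : E)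
      rfl
    rw [h1]
    exact map_maximalIdeal_le_asIdeal E q y₀ hy (Ideal.mem_map_of_mem _ hc)
  have hQeq : Q = 𝔫' := (Ideal.IsMaximal.eq_of_le h𝔫'max hQp.ne_top hle).symm
  -- so `L` is a localization of `E ⊗ C` at the maximal ideal `𝔫'`
  have hsub : t.asIdeal.primeCompl.map κ = 𝔫'.primeCompl := by
    ext x
    rw [Ideal.mem_primeCompl_iff, ← hQeq, hQ, Ideal.mem_comap, Submonoid.mem_map]
    constructor
    · rintro ⟨y, hy, rfl⟩
      change κ.symm.toRingHom (κ y) ∉ t.asIdeal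
      rwa [RingEquiv.toRingHom_eq_coe, RingHom.coe_coe, RingEquiv.symm_apply_apply]
    · intro hx
      exact ⟨κ.symm x, hx, κ.apply_symm_apply x⟩
  haveI : IsLocalization.AtPrime L 𝔫' := by
    have h := hloc'
    rw [hsub] at h
    exact h
  -- the two completion isomorphisms
  let e₁ : AdicCompletion 𝔫 C ≃+* AdicCompletion 𝔫' (E ⊗[D] C) := completionTensorBaseEquiv 𝔭 hR' 𝔫 h𝔫
  let e₂ : AdicCompletion 𝔫' (E ⊗[D] C) ≃+* LocalCpl L :=
    adicCompletionEquivOfIsLocalizationAtMaximal 𝔫' L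
  exact ⟨e₁.trans e₂⟩

end CompletionBaseChangeStalk

end Literature.AlgebraicGeometry.Resolution

end
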